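import Literature.AlgebraicGeometry.Resolution.AlterationsDimension
import Literature.AlgebraicGeometry.Resolution.AlterationsStrong
import Literature.AlgebraicGeometry.Resolution.RelativeDimensionCurve
import Mathlib.AlgebraicGeometry.Morphisms.Proper
import Mathlib.AlgebraicGeometry.Morphisms.Finite
import Mathlib.AlgebraicGeometry.Morphisms.UniversallyInjective
import HarnessLib

/-!
# `Pialt` (crux stmt-ResolutionOfSingularities-0555), line `SketchIdeator2`, Card B dimension count

Stub `stub_image_ne_univ_of_isClosed` of the lead's skeleton `indeterminacy-split` (helper file,
`--supports stmt-ResolutionOfSingularities-0555`; does not close the item).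

**Statement.** In the split situation of Card B — `X`, `Y` proper integral over a field `k`, a
finite surjective `ψ : V → U` from an open of `Y` onto a non-empty open of `X`, a proper
surjective `g : Y' → Y` from an integral `Y'`, finite over a dense open `V' ⊆ Y`, and a
`k`-morphism `ψ' : Y' → X` (`ψ' ≫ f = g ≫ h`) — no proper closed subset `C ⊊ Y'` maps ONTO
`X` under `ψ'`.

**Proof.** (1) `dim Y' = dim Y` because `g` is an alteration (de Jong 1996, 2.20,
`IsAlteration.topologicalKrullDim_eq`); `dim Y = dim V = dim U = dim X` by invariance of
dimension under non-empty opens of integral schemes locally of finite type over a field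
(`topologicalKrullDim_opens_eq`) and under the finite surjective `ψ`
(`Literature.AlgebraicGeometry.Motives.Scheme.topologicalKrullDim_eq_of_isFinite_of_surjective`);
all these dimensions are finite (`exists_topologicalKrullDim_le_of_locallyOfFiniteType`).
(2) `ψ'` is universally closed (`ψ' ≫ f = g ≫ h` is proper and `f` is separated). If
`ψ'(C) = X` then some `b ∈ C` lies over the generic point of `X`, and `b` is not the generic
point of `Y'` (else `C = Y'`); lifting chains of specialisations along the closed map `ψ'` and
prolonging by the generic point of `Y'` gives `dim X + 1 ≤ dim Y'`
(`topologicalKrullDim_base_add_one_le`), contradicting `dim Y' = dim X < ∞`.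
-/

set_option linter.dupNamespace false -- mandated namespace of this single-conjunct summit

noncomputable section

open CategoryTheory CategoryTheory.Limits AlgebraicGeometry TopologicalSpace
open Literature.AlgebraicGeometry.Resolution

namespace Summit.ResolutionOfSingularities.ResolutionOfSingularities.Theorems.Pialt.IndeterminacySplit

universe u

/-- **No proper closed subset maps onto the target under a universally closed morphism of
irreducible schemes of the same finite dimension.** If `φ : Y' ⟶ X` is universally closed,
`Y'` and `X` are irreducible with `dim Y' = dim X < ∞`, and `C ⊊ Y'` is a proper closed subset,
then `φ(C) ≠ X`: otherwise some `b ∈ C`, necessarily different from the generic point of `Y'`,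
lies over the generic point of `X`, and then `dim X + 1 ≤ dim Y'`
(`topologicalKrullDim_base_add_one_le`: chains of specialisations of `X` lift along the closed
map `φ` to chains ending at `b`, prolonged by the generic point of `Y'`). [folklore] -/
theorem image_ne_univ_of_topologicalKrullDim_eq {Y' X : Scheme.{u}} (φ : Y' ⟶ X)
    [UniversallyClosed φ] [IrreducibleSpace Y'] [IrreducibleSpace X]
    (hdim : topologicalKrullDim Y' = topologicalKrullDim X) (htop : topologicalKrullDim X ≠ ⊤)
    {C : Set Y'} (hC : IsClosed C) (hCne : C ≠ Set.univ) : φ.base '' C ≠ Set.univ := by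
  intro hCimg
  -- a point `b ∈ C` over the generic point of `X`
  obtain ⟨b, hbC, hb⟩ : genericPoint X ∈ φ.base '' C := by
    rw [hCimg]
    exact Set.mem_univ _
  -- `b` is not the generic point of `Y'`, since `C ≠ Y'` is closed
  have hbne : b ≠ genericPoint Y' := by
    rintro rfl
    apply hCne
    have hsub := closure_minimal (Set.singleton_subset_iff.mpr hbC) hC
    rw [genericPoint_closure] at hsub
    exact Set.univ_subset_iff.mp hsub
  -- `dim X + 1 ≤ dim Y' = dim X`, absurd for a finite non-`⊥` dimension
  have hle : topologicalKrullDim X + 1 ≤ topologicalKrullDim X := by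
    have h1 := topologicalKrullDim_base_add_one_le φ hb hbne
    rwa [hdim] at h1
  have hbot : topologicalKrullDim X ≠ ⊥ := by
    unfold topologicalKrullDim
    rw [ne_eq, Order.krullDim_eq_bot_iff, not_isEmpty_iff]
    exact ⟨⟨Set.univ, IrreducibleSpace.isIrreducible_univ X, isClosed_univ⟩⟩
  exact lt_irrefl _ (WithBot.ENat.lt_of_add_one_le hle hbot htop)

/-- **A scheme of finite type over a field has finite dimension**, in the form
`topologicalKrullDim X ≠ ⊤` for `X` quasi-compact and locally of finite type over `Spec k`
(cover by finitely many affine opens, each a closed subscheme of an affine space;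
`exists_topologicalKrullDim_le_of_locallyOfFiniteType`). [folklore] -/
theorem topologicalKrullDim_ne_top_of_locallyOfFiniteType {k : Type u} [Field k]
    {X : Scheme.{u}} (f : X ⟶ Spec (.of k)) [LocallyOfFiniteType f] [QuasiCompact f] :
    topologicalKrullDim X ≠ ⊤ := by
  haveI : CompactSpace X :=
    (HasAffineProperty.iff_of_isAffine (P := @QuasiCompact)).mp ‹QuasiCompact f›
  obtain ⟨d, hd⟩ := exists_topologicalKrullDim_le_of_locallyOfFiniteType f
  intro htop
  rw [htop, ← WithBot.coe_top, ← WithBot.coe_natCast, WithBot.coe_le_coe] at hd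
  exact absurd hd (not_le_of_gt (ENat.coe_lt_top d))

/-- **Card B dimension count** (stub `stub_image_ne_univ_of_isClosed` of the line
`SketchIdeator2` / Card B `indeterminacy-split`). In the split situation — `X`, `Y` proper and
integral over `k`, `ψ : V → U` finite surjective from an open of `Y` onto a non-empty open of
`X`, `g : Y' → Y` proper surjective from an integral `Y'` and finite over a dense open `V'`, and
`ψ' : Y' → X` over `k` — no proper closed subset `C ⊊ Y'` maps onto `X` under `ψ'`. Indeed
`dim Y' = dim Y` (de Jong 1996, 2.20: alterations preserve dimension), `dim Y = dim V = dim U =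
dim X` (non-empty opens of integral schemes locally of finite type over a field; finite
surjective morphisms), all finite; and `ψ'` is universally closed (`ψ' ≫ f = g ≫ h` proper, `f`
separated), so `image_ne_univ_of_topologicalKrullDim_eq` applies. The hypotheses that `ψ` and
`g ∣_ V'` are universally injective and the square `hcomm` are part of the registered split data
but are not needed for the count. [cite: DeJong1996, 2.20, p. 61] -/
theorem stub_image_ne_univ_of_isClosed (k : Type) [Field k] (X : Scheme.{0})
    (f : X ⟶ Spec (.of k)) [IsProper f] [IsIntegral X] (Y : Scheme.{0})
    (h : Y ⟶ Spec (.of k)) [IsProper h] [IsIntegral Y] (U : X.Opens) (V : Y.Opens)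
    (ψ : (V : Scheme.{0}) ⟶ (U : Scheme.{0})) (hU : (U : Set X).Nonempty) [IsFinite ψ]
    [UniversallyInjective ψ] (hψs : Function.Surjective ψ.base)
    (hcomm : V.ι ≫ h = ψ ≫ U.ι ≫ f) (Y' : Scheme.{0}) [IsIntegral Y'] (g : Y' ⟶ Y)
    [IsProper g] (hgs : Function.Surjective g.base) (V' : Y.Opens) (hV' : Dense (V' : Set Y))
    [IsFinite (g ∣_ V')] [UniversallyInjective (g ∣_ V')] (ψ' : Y' ⟶ X)
    (hψ' : ψ' ≫ f = g ≫ h) :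
    ∀ C : Set Y', IsClosed C → C ≠ Set.univ → ψ'.base '' C ≠ Set.univ := by
  have _ := hcomm
  intro C hC hCne
  -- (0) `ψ'` is universally closed: `ψ' ≫ f = g ≫ h` is proper and `f` is separated
  haveI : UniversallyClosed (ψ' ≫ f) := by
    rw [hψ']
    infer_instance
  haveI : UniversallyClosed ψ' := .of_comp_of_isSeparated ψ' f
  -- (1) `dim Y' = dim Y`: `g` is an alteration (finite over the dense, hence non-empty, `V'`)
  haveI : Surjective g := ⟨hgs⟩
  have hga : IsAlteration g :=
    { isIntegral := inferInstance
      isProper := inferInstance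
      isDominant := inferInstance
      exists_isFinite := ⟨V', hV'.nonempty, inferInstance⟩ }
  -- `V` is non-empty: `ψ` maps it onto the non-empty `U`
  have hVne : (V : Set Y).Nonempty := by
    obtain ⟨x, hx⟩ := hU
    obtain ⟨v, -⟩ := hψs ⟨x, hx⟩
    exact ⟨v.1, v.2⟩
  -- `dim Y' = dim Y = dim V = dim U = dim X`
  have hdim : topologicalKrullDim Y' = topologicalKrullDim X := by
    haveI : Surjective ψ := ⟨hψs⟩
    rw [hga.topologicalKrullDim_eq h, ← topologicalKrullDim_opens_eq h V hVne,
      ← topologicalKrullDim_opens_eq f U hU]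
    exact
      Literature.AlgebraicGeometry.Motives.Scheme.topologicalKrullDim_eq_of_isFinite_of_surjective ψ
  -- (2) conclude by the dimension count along the universally closed `ψ'`
  exact image_ne_univ_of_topologicalKrullDim_eq ψ' hdim
    (topologicalKrullDim_ne_top_of_locallyOfFiniteType f) hC hCne

end Summit.ResolutionOfSingularities.ResolutionOfSingularities.Theorems.Pialt.IndeterminacySplit

end
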